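import Literature.AlgebraicGeometry.Frobenioids.ArchimedeanProp35iiiStdBaseRC
import Literature.AlgebraicGeometry.Frobenioids.ArchimedeanProp35iiiCounterexample
import HarnessLib

/-!
# Frobenioids II, Proposition 3.5 (iii) for `N` FAILS over a base of RC-STANDARD type — so [FrdII] Cor. 4.2 (v)
# («`D` of RC-standard type ⇒ so is `N`») does not hold as printed (kernel COUNTEREXAMPLE; strengthening of
# finding P35iii-F1 from a non-complexifiable base to a base satisfying ALL hypotheses of [FrdII] Thm. 3.6)

Mochizuki, *The geometry of Frobenioids II: poly-Frobenioids*, Kyushu J. Math. **62** (2008) 401–460, §3,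
Proposition 3.5 p. 34 (journal pp. 428–430): "In the notation and terminology of Example 3.3 … Suppose further that
`D` is of RC-iso-subanchor type. Then … (iii) `G` [`= N`, `R`] is of RC-iso-subanchor type", with proof "Just as in
the case of assertion (ii), we may apply assertion (i) to conclude that …"; Corollary 4.2 (v) (journal p. 437): "If
(for `i = 1, 2`) `D_i` is of RC-standard type, then so is `G_i`. In particular, in this case, `G_i` satisfies all of
the hypotheses on «`D`» in Theorem 3.6 (i) and (ii)", proof p. 439 l. 15–16: "assertion (v) follows formally from
Proposition 3.4 (viii) and 3.5 (iii)" [cite: MochizukiFrdII2008, Prop 3.5 (iii) p.34].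

PROOF-ONLY file (abc-iut cell, layer L1, node `FrdII:Prop3.5(iii)`, sub-row P35iii-STD; seat abc-iut-w4-d027 gen 3).
The typed instance `ArchFrd.Prop35iii_N π` (abc-iut-L1-t9) was refuted by gen 2 at the conjugation-COLLAPSING base
`D₀ → D₀` (`not_prop35iii_N_collapse`), which is NOT complexifiable, and proved at every base whose real objects
carry Galois-saturated quotient data (`ArchimedeanPointBaseProp35N.lean`: complex-image bases, faithful bases, the
one-morphism base of [IUTchI] Ex. 3.4 (i), the RC-standard base `T → D₀`). This file closes the remaining question:
**over the four-object base `S → D₀` of `ArchimedeanProp35iiiStdBase.lean`, which is of RC-STANDARD type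
(`P35iiiStd.isOfRCStandardType` — every hypothesis on `D` of [FrdII] Thm. 3.6), `N` is NOT of RC-iso-subanchor
type** (`not_isRCIsoSubanchor_unitObj_N`, `not_prop35iii_N_std`). The real unit object `A` of `N` over `a` admits
no presentation `(B, Γ ⊆ Aut_N(B), f : B → A)` as a categorical quotient of an RC-subanchor `B`: such a `B` is
complex, so lies over `b`, `c` or `d`, and
* over `b` or `d` the base functor kills the image of `Γ` in `D` (`Aut(b) ↦ 𝟙`, `Aut(d) = 1`), whence every `γ ∈ Γ`
  acts on the `C₀`-component over the identity of `Spec ℂ`, and gen 2's PHASE TWIST `(f₀ with scalar i·c, f_D)`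
  is a `Γ`-invariant arrow of `N` not factoring through `f` (`no_quotient_of_killed`, the mechanism of
  `not_prop35iii_N_collapse` for an arbitrary base);
* over `c` (where `β ↦` conjugation IS available — `S` is complexifiable through `c`) the two arrows `h ≠ h′ : c → a`
  are both fixed by `Aut(c)` and `End(a) = 1`: the arrow `(f₀, h′)` of `N` (same `C₀`-component as `f = (f₀, h)`,
  the other `D`-component) is `Γ`-invariant as `f` is and a factorisation `f ≫ ψ'` would force `h = h′`
  (`no_quotient_over_c`) — a D-RIGIDITY obstruction independent of Galois saturation.
Hence **`exists_rcStandard_base_not_prop35iii_N`**: there is a connected base `D → D₀` of RC-standard type at which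
[FrdII] Prop. 3.5 (iii) fails for `N`; consequently [FrdII] Cor. 4.2 (v) fails for `N` as printed (`N` over an
RC-standard `D` need not even be of RC-iso-subanchor type; [FrdII] §4 is not cited by [IUTchI–IV] — record only).
Reading (neutral): over base categories of Galois type with the functor to `D₀` induced by the archimedean
decomposition, quotient data are Galois-saturated and parallel arrows over `Spec ℂ → Spec ℝ` that are identified by
every automorphism do not occur; both mechanisms live in the generality «any connected, totally epimorphic `D` with a
functor `D → D₀`» in which Example 3.3 / Prop. 3.5 / Cor. 4.2 are phrased. FINDING about printed items of a
refereed prerequisite paper; no side is taken on [IUTchIII] Cor. 3.12; typed ≠ proved except where a `theorem` says so.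
-/

namespace Literature.AlgebraicGeometry.Frobenioids

open CategoryTheory
open scoped Pointwise

noncomputable section

namespace ArchFrd

namespace P35iiiStd

open S

/-! ### Mechanism 1 (phase twist): no quotient presentation over an object whose automorphisms the base kills -/

/-- **No categorical-quotient presentation of the real unit object of `N` by a group acting over the identity of
`Spec ℂ`**: if `B` is complex and every `γ ∈ Γ` has `D`-component killed by the base functor, then `f : B → A` is not
a categorical quotient of `B` by `Γ` in `N` — the phase twist `(Base f₀, deg f₀, i · c_{f₀}; f_D)` is `Γ`-invariant
and does not factor through `f` (an endomorphism of the real `A` has real scalar). This is the mechanism of gen 2's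
`not_prop35iii_N_collapse`, valid over any base. [cite: MochizukiFrdII2008, Prop 3.5 (iii) p.34] -/
theorem no_quotient_of_killed (B : N Literature.AlgebraicGeometry.Frobenioids.ArchFrd.P35iiiStd.toD0) (Γ : Subgroup (Aut B)) (f : B ⟶ (⟨⟨unitObjOver Literature.AlgebraicGeometry.Frobenioids.ArchFrd.P35iiiStd.toD0 a⟩⟩ : N Literature.AlgebraicGeometry.Frobenioids.ArchFrd.P35iiiStd.toD0))
    (hBc : B.obj.obj.fst.base = D0.complex)
    (hkill : ∀ γ ∈ Γ, Literature.AlgebraicGeometry.Frobenioids.ArchFrd.P35iiiStd.toD0.map (γ.hom.hom.hom).snd = 𝟙 (Literature.AlgebraicGeometry.Frobenioids.ArchFrd.P35iiiStd.toD0.obj B.obj.obj.snd))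
    (hq : IsCategoricalQuotient Γ f) : False := by
  obtain ⟨hinv, huniq⟩ := hq
  -- notation for the `C₀`-component `f₀ = (b, d, c)` of `f`
  set fC := f.hom.hom with hfC
  set bb := C0.Base fC.fst with hb
  set dd := C0.degFr fC.fst with hd
  set cc := C0.scalar fC.fst with hc
  have hiso : (unitObjOver Literature.AlgebraicGeometry.Frobenioids.ArchFrd.P35iiiStd.toD0 a).fst.region.IsIsotropic := AngularRegion.isIsotropic_isotropicOfTip 1
  -- the arrow `ψ₀ = (b, d, i·c) : B₀ → A₀` of `C₀`
  let ψ₀ : B.obj.obj.fst ⟶ (unitObjOver Literature.AlgebraicGeometry.Frobenioids.ArchFrd.P35iiiStd.toD0 a).fst :=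
    { base := bb
      degFr := dd
      scalar := unitI * cc
      scalar_mem := by
        rw [hBc, D0.scalars_complex]
        exact Subgroup.mem_top _
      mapsTo := by
        have hf := (fC.fst).mapsTo
        intro x hx
        obtain ⟨y, hy, rfl⟩ := Set.mem_smul_set.mp hx
        have hy' : cc • y ∈ C0.pullRegion (unitObjOver Literature.AlgebraicGeometry.Frobenioids.ArchFrd.P35iiiStd.toD0 a).fst bb := hf (Set.smul_mem_smul_set hy)
        unfold C0.pullRegion at hy' ⊢
        rw [C0.image_galAct_of_isIsotropic hiso] at hy' ⊢
        rw [C0.mem_carrier_of_isIsotropic hiso] at hy' ⊢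
        rw [smul_eq_mul] at hy' ⊢
        rw [mul_assoc, map_mul, absHom_unitI, one_mul]
        exact hy' }
  -- `ψ₀` has the same `Div` as `f₀` (`|i| = 1`)
  have hdiv : C0.div ψ₀ = C0.div fC.fst := by
    have hr : C0.ratio ψ₀ = C0.ratio fC.fst := by
      unfold C0.ratio
      change _ / (‖((unitI * cc : ℂˣ) : ℂ)‖ * _ ^ (dd : ℕ)) = _ / (‖(cc : ℂ)‖ * _ ^ (dd : ℕ))
      rw [Units.val_mul, norm_mul]
      simp [unitI]
    unfold C0.div
    simp only [hr]
  -- … the arrow `ψ_C = (ψ₀, f_D)` of `C`, with the same compatibility square as `f`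
  let ψC : B.obj.obj ⟶ unitObjOver Literature.AlgebraicGeometry.Frobenioids.ArchFrd.P35iiiStd.toD0 a := ⟨ψ₀, fC.snd, fC.w⟩
  have hψiso : PreFrobenioid.isometricMorphisms (C.toElem Literature.AlgebraicGeometry.Frobenioids.ArchFrd.P35iiiStd.toD0) ψC := by
    have hfiso : PreFrobenioid.Div (C.toElem Literature.AlgebraicGeometry.Frobenioids.ArchFrd.P35iiiStd.toD0) fC = 1 := f.hom.property
    have e1 : PreFrobenioid.Div C0.toElem ψC.fst = PreFrobenioid.Div C0.toElem fC.fst := hdiv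
    have key : PreFrobenioid.Div (C.toElem Literature.AlgebraicGeometry.Frobenioids.ArchFrd.P35iiiStd.toD0) ψC = PreFrobenioid.Div (C.toElem Literature.AlgebraicGeometry.Frobenioids.ArchFrd.P35iiiStd.toD0) fC := by
      rw [PreFrobenioid.fiberProduct_div, PreFrobenioid.fiberProduct_div, e1]
    change PreFrobenioid.Div (C.toElem Literature.AlgebraicGeometry.Frobenioids.ArchFrd.P35iiiStd.toD0) ψC = 1
    rw [key]
    exact hfiso
  have hψlin : PreFrobenioid.linearMorphisms (A.toElem Literature.AlgebraicGeometry.Frobenioids.ArchFrd.P35iiiStd.toD0)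
      (⟨ψC, hψiso⟩ : B.obj ⟶ (⟨unitObjOver Literature.AlgebraicGeometry.Frobenioids.ArchFrd.P35iiiStd.toD0 a⟩ : A Literature.AlgebraicGeometry.Frobenioids.ArchFrd.P35iiiStd.toD0)) := f.property
  let ψ : B ⟶ (⟨⟨unitObjOver Literature.AlgebraicGeometry.Frobenioids.ArchFrd.P35iiiStd.toD0 a⟩⟩ : N Literature.AlgebraicGeometry.Frobenioids.ArchFrd.P35iiiStd.toD0) := ⟨⟨ψC, hψiso⟩, hψlin⟩
  -- every `γ ∈ Γ` has `C₀`-component over the identity of `Spec ℂ` (its `D`-component is killed)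
  have hγb : ∀ γ ∈ Γ, C0.Base (γ.hom.hom.hom).fst = 𝟙 _ := by
    intro γ hγ
    have w := (γ.hom.hom.hom).w
    rw [hkill γ hγ, Category.comp_id] at w
    exact (cancel_mono B.obj.obj.iso.hom).1 (w.trans (Category.id_comp _).symm)
  -- `ψ` is `Γ`-invariant, exactly as `f` is
  have hψ : ∀ γ ∈ Γ, γ.hom ≫ ψ = ψ := by
    intro γ hγ
    have h1 : γ.hom.hom.hom ≫ fC = fC := by rw [hfC, ← N.hom_hom_comp, hinv γ hγ]
    have hfst : (γ.hom.hom.hom).fst ≫ fC.fst = fC.fst := congrArg CFP.Hom.fst h1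
    have hsnd : (γ.hom.hom.hom).snd ≫ fC.snd = fC.snd := congrArg CFP.Hom.snd h1
    have hdeg : C0.degFr (γ.hom.hom.hom).fst * dd = dd := by
      have h2 := congrArg C0.degFr hfst
      rwa [C0.degFr_comp'] at h2
    have hsc : (C0.Base (γ.hom.hom.hom).fst).act cc * C0.scalar (γ.hom.hom.hom).fst ^ (dd : ℕ) = cc := by
      have h2 := congrArg C0.scalar hfst
      rwa [C0.scalar_comp'] at h2
    rw [hγb γ hγ] at hsc
    unfold D0.Hom.act at hsc
    rw [D0.twists_id, D0.galAct_false] at hsc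
    refine N.hom_ext' Literature.AlgebraicGeometry.Frobenioids.ArchFrd.P35iiiStd.toD0 (CFP.hom_ext (C0.hom_ext ?_ ?_ ?_) hsnd)
    · change C0.Base (γ.hom.hom.hom).fst ≫ bb = bb
      rw [hγb γ hγ, Category.id_comp]
    · change C0.degFr (γ.hom.hom.hom).fst * dd = dd
      exact hdeg
    · change (C0.Base (γ.hom.hom.hom).fst).act (unitI * cc) * C0.scalar (γ.hom.hom.hom).fst ^ (dd : ℕ) = unitI * cc
      rw [hγb γ hγ]
      unfold D0.Hom.act
      rw [D0.twists_id, D0.galAct_false, mul_assoc, hsc]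
  -- but `ψ` does not factor through `f`: the factor would be an endomorphism of the REAL object `A` with scalar `i`
  obtain ⟨ψ', hψ', -⟩ := huniq ψ hψ
  have hC : fC ≫ ψ'.hom.hom = ψC := by rw [hfC, ← N.hom_hom_comp, hψ']
  have hfst : fC.fst ≫ (ψ'.hom.hom).fst = ψ₀ := congrArg CFP.Hom.fst hC
  have hd1 : C0.degFr (ψ'.hom.hom).fst = 1 := by
    have h2 := congrArg C0.degFr hfst
    rw [C0.degFr_comp'] at h2
    change dd * C0.degFr (ψ'.hom.hom).fst = dd at h2
    exact mul_left_cancel (h2.trans (mul_one dd).symm)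
  have hs : C0.scalar (ψ'.hom.hom).fst = unitI := by
    have h2 := congrArg C0.scalar hfst
    rw [C0.scalar_comp', hd1, PNat.one_coe, pow_one] at h2
    change bb.act (C0.scalar (ψ'.hom.hom).fst) * cc = unitI * cc at h2
    have hbt : D0.Hom.twists bb = false := D0.twists_of_real bb
    unfold D0.Hom.act at h2
    rw [hbt, D0.galAct_false] at h2
    exact mul_right_cancel h2
  have hmem : C0.scalar (ψ'.hom.hom).fst ∈ D0.scalars D0.real := (ψ'.hom.hom).fst.scalar_mem
  rw [hs] at hmem
  exact unitI_not_mem_scalars_real hmem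

/-! ### Mechanism 2 (`D`-rigidity): no quotient presentation over `c` -/

/-- **No categorical-quotient presentation of the real unit object of `N` over `c`**: if `f : B → A` has
`D`-component `h_k : c → a`, the arrow `(f₀, h_{¬k})` of `N` — the same `C₀`-component, the OTHER arrow `c → a`,
still fixed by `Aut(c)` — is `Γ`-invariant as `f` is, and `f ≫ ψ' = (f₀, h_{¬k})` would give `h_k = h_{¬k}`
(`End(a) = 1`). [cite: MochizukiFrdII2008, Prop 3.5 (iii) p.34] -/
theorem no_quotient_over_c (B₀ : C0) (eB : (PreFrobenioid.baseFunctor C0.toElem).obj B₀ ≅ Literature.AlgebraicGeometry.Frobenioids.ArchFrd.P35iiiStd.toD0.obj c)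
    (Γ : Subgroup (Aut (⟨⟨⟨B₀, c, eB⟩⟩⟩ : N Literature.AlgebraicGeometry.Frobenioids.ArchFrd.P35iiiStd.toD0))) (f : (⟨⟨⟨B₀, c, eB⟩⟩⟩ : N Literature.AlgebraicGeometry.Frobenioids.ArchFrd.P35iiiStd.toD0) ⟶ (⟨⟨unitObjOver Literature.AlgebraicGeometry.Frobenioids.ArchFrd.P35iiiStd.toD0 a⟩⟩ : N Literature.AlgebraicGeometry.Frobenioids.ArchFrd.P35iiiStd.toD0))
    (hq : IsCategoricalQuotient Γ f) : False := by
  obtain ⟨hinv, huniq⟩ := hq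
  set fC := f.hom.hom with hfC
  obtain ⟨k, hk⟩ := hom_ca_eq fC.snd
  -- the arrow `(f₀, h_{¬k})` of `C`: same compatibility square since `π h = π h′`
  have hmap : Literature.AlgebraicGeometry.Frobenioids.ArchFrd.P35iiiStd.toD0.map fC.snd = Literature.AlgebraicGeometry.Frobenioids.ArchFrd.P35iiiStd.toD0.map (hHom (!k)) := by rw [hk]; rfl
  let ψC : (⟨B₀, c, eB⟩ : C Literature.AlgebraicGeometry.Frobenioids.ArchFrd.P35iiiStd.toD0) ⟶ unitObjOver Literature.AlgebraicGeometry.Frobenioids.ArchFrd.P35iiiStd.toD0 a := ⟨fC.fst, hHom (!k), fC.w.trans (by rw [hmap]; rfl)⟩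
  have hψiso : PreFrobenioid.isometricMorphisms (C.toElem Literature.AlgebraicGeometry.Frobenioids.ArchFrd.P35iiiStd.toD0) ψC := by
    have hfiso : PreFrobenioid.Div (C.toElem Literature.AlgebraicGeometry.Frobenioids.ArchFrd.P35iiiStd.toD0) fC = 1 := f.hom.property
    have key : PreFrobenioid.Div (C.toElem Literature.AlgebraicGeometry.Frobenioids.ArchFrd.P35iiiStd.toD0) ψC = PreFrobenioid.Div (C.toElem Literature.AlgebraicGeometry.Frobenioids.ArchFrd.P35iiiStd.toD0) fC := by
      rw [PreFrobenioid.fiberProduct_div, PreFrobenioid.fiberProduct_div]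
    change PreFrobenioid.Div (C.toElem Literature.AlgebraicGeometry.Frobenioids.ArchFrd.P35iiiStd.toD0) ψC = 1
    rw [key]
    exact hfiso
  have hψlin : PreFrobenioid.linearMorphisms (A.toElem Literature.AlgebraicGeometry.Frobenioids.ArchFrd.P35iiiStd.toD0)
      (⟨ψC, hψiso⟩ : (⟨⟨B₀, c, eB⟩⟩ : A Literature.AlgebraicGeometry.Frobenioids.ArchFrd.P35iiiStd.toD0) ⟶ (⟨unitObjOver Literature.AlgebraicGeometry.Frobenioids.ArchFrd.P35iiiStd.toD0 a⟩ : A Literature.AlgebraicGeometry.Frobenioids.ArchFrd.P35iiiStd.toD0)) := f.property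
  let ψ : (⟨⟨⟨B₀, c, eB⟩⟩⟩ : N Literature.AlgebraicGeometry.Frobenioids.ArchFrd.P35iiiStd.toD0) ⟶ (⟨⟨unitObjOver Literature.AlgebraicGeometry.Frobenioids.ArchFrd.P35iiiStd.toD0 a⟩⟩ : N Literature.AlgebraicGeometry.Frobenioids.ArchFrd.P35iiiStd.toD0) := ⟨⟨ψC, hψiso⟩, hψlin⟩
  -- `ψ` is `Γ`-invariant: its `C₀`-component is that of `f`, and `Aut(c)` fixes every arrow `c → a`
  have hψ : ∀ γ ∈ Γ, γ.hom ≫ ψ = ψ := by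
    intro γ hγ
    have h1 : γ.hom.hom.hom ≫ fC = fC := by rw [hfC, ← N.hom_hom_comp, hinv γ hγ]
    have hfst : (γ.hom.hom.hom).fst ≫ fC.fst = fC.fst := congrArg CFP.Hom.fst h1
    refine N.hom_ext' Literature.AlgebraicGeometry.Frobenioids.ArchFrd.P35iiiStd.toD0 (CFP.hom_ext hfst ?_)
    exact endo_comp_hom_ca _ _
  -- a factorisation through `f` would identify `h` and `h′` (`End(a) = 1`)
  obtain ⟨ψ', hψ', -⟩ := huniq ψ hψ
  have hC : fC ≫ ψ'.hom.hom = ψC := by rw [hfC, ← N.hom_hom_comp, hψ']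
  have hsnd : fC.snd ≫ (ψ'.hom.hom).snd = hHom (!k) := congrArg CFP.Hom.snd hC
  have key : ∀ x : a ⟶ a, hHom k ≫ x = hHom (!k) → False := fun x hx => by
    have hx1 : x = 𝟙 a := Subsingleton.elim _ _
    subst hx1
    rw [Category.comp_id] at hx
    exact Bool.not_ne_self k (Hom.h.inj hx).symm
  exact key _ (by rw [← hk]; exact hsnd)

/-! ### The refutation -/

/-- **The real unit object of `N` over the RC-standard base `S → D₀` is NOT an RC-iso-subanchor of `N`.**
[cite: MochizukiFrdII2008, Prop 3.5 (iii) p.34] -/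
theorem not_isRCIsoSubanchor_unitObj_N :
    ¬ RC.IsRCIsoSubanchor (N.toC Literature.AlgebraicGeometry.Frobenioids.ArchFrd.P35iiiStd.toD0 ⋙ PreFrobenioid.baseFunctor (C.toElem Literature.AlgebraicGeometry.Frobenioids.ArchFrd.P35iiiStd.toD0) ⋙ baseRC Literature.AlgebraicGeometry.Frobenioids.ArchFrd.P35iiiStd.toD0) (⟨⟨unitObjOver Literature.AlgebraicGeometry.Frobenioids.ArchFrd.P35iiiStd.toD0 a⟩⟩ : N Literature.AlgebraicGeometry.Frobenioids.ArchFrd.P35iiiStd.toD0) := by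
  rintro ⟨B, Γ, f, ⟨B', ⟨hB'c, -⟩, ⟨g⟩⟩, hq, -⟩
  -- `B'` lies over `Spec ℂ`, hence so does `B` (only complex objects map to complex objects)
  have hB'snd : Literature.AlgebraicGeometry.Frobenioids.ArchFrd.P35iiiStd.toD0.obj B'.obj.obj.snd = D0.complex := N.isComplex_of_complexObjects Literature.AlgebraicGeometry.Frobenioids.ArchFrd.P35iiiStd.toD0 B' hB'c
  have hBc : B.obj.obj.fst.base = D0.complex := by
    have k : B.obj.obj.fst.base ⟶ Literature.AlgebraicGeometry.Frobenioids.ArchFrd.P35iiiStd.toD0.obj B'.obj.obj.snd := B.obj.obj.iso.hom ≫ Literature.AlgebraicGeometry.Frobenioids.ArchFrd.P35iiiStd.toD0.map (g.hom.hom).snd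
    rw [hB'snd] at k
    exact D0.eq_complex_of_hom_complex k
  have hXc : Literature.AlgebraicGeometry.Frobenioids.ArchFrd.P35iiiStd.toD0.obj B.obj.obj.snd = D0.complex :=
    D0.eq_complex_of_hom_complex (B.obj.obj.iso.inv ≫ eqToHom hBc)
  -- so `B` lies over `b`, `c` or `d`
  obtain ⟨⟨⟨B₀, X, eB⟩⟩⟩ := B
  cases X with
  | a =>
    have h1 : D0.real = D0.complex := hXc
    cases h1
  | b => exact no_quotient_of_killed _ Γ f hBc (fun γ _ => toD0_map_endo_b _) hq
  | c => exact no_quotient_over_c B₀ eB Γ f hq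
  | d => exact no_quotient_of_killed _ Γ f hBc (fun γ _ => toD0_map_endo_d _) hq

/-- **[FrdII] Proposition 3.5 (iii) for `N` FAILS over the RC-standard base `S → D₀`** (typed instance
`ArchFrd.Prop35iii_N`). [cite: MochizukiFrdII2008, Prop 3.5 (iii) p.34] -/
theorem not_prop35iii_N_std : ¬ Literature.AlgebraicGeometry.Frobenioids.ArchFrd.Prop35iii_N Literature.AlgebraicGeometry.Frobenioids.ArchFrd.P35iiiStd.toD0 := fun h =>
  not_isRCIsoSubanchor_unitObj_N ((h isOfRCIsoSubanchorType).isRCIsoSubanchor _)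

/-- **`N` over the RC-standard base `S → D₀` is NOT of RC-iso-subanchor type** — in particular NOT of RC-standard
type: [FrdII] Cor. 4.2 (v) («if `D` is of RC-standard type, then so is `N`») fails as printed at this base.
[cite: MochizukiFrdII2008, Prop 3.5 (iii) p.34] -/
theorem not_isOfRCIsoSubanchorType_N_std :
    ¬ RC.IsOfRCIsoSubanchorType (N.toC Literature.AlgebraicGeometry.Frobenioids.ArchFrd.P35iiiStd.toD0 ⋙ PreFrobenioid.baseFunctor (C.toElem Literature.AlgebraicGeometry.Frobenioids.ArchFrd.P35iiiStd.toD0) ⋙ baseRC Literature.AlgebraicGeometry.Frobenioids.ArchFrd.P35iiiStd.toD0) := fun h =>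
  not_isRCIsoSubanchor_unitObj_N (h.isRCIsoSubanchor _)

/-- **Kernel record, packaged**: there is a connected base `D → D₀` of RC-STANDARD type ([FrdII] Def. 3.1 (v): totally
epimorphic, RC-connected, complexifiable, FSMFF, of RC-iso-subanchor type — every hypothesis on `D` in [FrdII]
Thm. 3.6) over which the non-rigidified angloid `N` of Example 3.3 is NOT of RC-iso-subanchor type, i.e. at which
Proposition 3.5 (iii) fails for `N` and Corollary 4.2 (v) fails for `N`. [cite: MochizukiFrdII2008, Prop 3.5 (iii) p.34] -/
theorem exists_rcStandard_base_not_prop35iii_N :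
    ∃ (D : Type) (_ : Category.{0} D) (π : D ⥤ D0), IsGraphConnected D ∧ RC.IsOfRCStandardType (baseRC π) ∧
      ¬ RC.IsOfRCIsoSubanchorType (N.toC π ⋙ PreFrobenioid.baseFunctor (C.toElem π) ⋙ baseRC π) ∧
        ¬ Literature.AlgebraicGeometry.Frobenioids.ArchFrd.Prop35iii_N π :=
  ⟨S, inferInstance, Literature.AlgebraicGeometry.Frobenioids.ArchFrd.P35iiiStd.toD0, S.isGraphConnected, isOfRCStandardType, not_isOfRCIsoSubanchorType_N_std,
    not_prop35iii_N_std⟩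

end P35iiiStd

end ArchFrd

end

end Literature.AlgebraicGeometry.Frobenioids
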